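import Summits.ValiantsHypothesis.ValiantsHypothesis.Theorems.KPlusLogSqLawOctaveIntegerisation
import Summits.ValiantsHypothesis.ValiantsHypothesis.Theorems.KPlusLogSqLawOctaveRootNearBreakpoint

/-!
# Route «KPlusLogSqLaw», octave line — depth-free direction, step 1: DOMINATED classes are free (`dominatedClassLifting_proof`), dead classes (`DeadClassLifting`, typed), `deadClassLifting_of_dominated`

HONEST FRAMING.  Prover seat val-width-19561-oc1 (re-target by director-valiant g9, 2026-08-27T23:36:52Z: «THEORY on the first depth-FREE piece toward Ω-W»), `--supports stmt-ValiantsHypothesis-19561`.  `OctaveWeakLifting` (Ω-W) is depth-free and OPEN; `WeakLifting` (stmt-19561), `TropicalB` (stmt-19771), Conjecture B are OPEN; the candidate statements `DeadClassLifting` and `NewtonBreakLifting` are DEFINED, NOT asserted.  Nothing here bears on their truth; VP ≠ VNP is not moved.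

This file: `classMass`, `IsDeadClass`, `IsTopClass`, `LiveDepthLE`, `TopDepthLE`, `DominatedClassLifting` (PROVED: the rung's bound under the depth inequality for TOP classes only), `DeadClassLifting` (NOT asserted), `rawConfinement_oneClass`, `rootNearBreakpoint_of_topDepthLE`, `shallowOctaveLifting_of_dominatedClassLifting`, `deadClassLifting_of_dominated` (dead classes below the live envelope create no octaves).
-/

set_option linter.dupNamespace false
set_option autoImplicit false

namespace Summit.ValiantsHypothesis.ValiantsHypothesis.Theorems.KPlusLogSqLaw.Octave

open Polynomial Finset
open scoped BigOperators

/-! ## Depth-free direction, step 1 (val-width-19561-oc1): DOMINATED classes are free; dead classes; the octave–Newton lemma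

HONEST FRAMING.  `OctaveWeakLifting` (Ω-W) is depth-FREE and OPEN.  The rung `ShallowOctaveLifting` demands cancellation depth `≤ Δ`
in EVERY slope class, which excludes every pencil with a DEAD class (a class whose raw Leibniz terms cancel exactly).  Here:
* `TopDepthLE` — the depth inequality is demanded ONLY for classes that reach the top of the design envelope at some `θ`
  (dominated classes may be dead or arbitrarily deep); `dominatedClassLifting_proof : DominatedClassLifting` — the rung's bound
  VERBATIM under this weaker hypothesis (the confinement argument uses depth only at the class of the top raw term), hence
  `shallowOctaveLifting_of_dominatedClassLifting` and `deadClassLifting_of_dominated` (dead classes lying weakly below the live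
  envelope create no octaves);
* `DeadClassLifting` — `DepthLE` relaxed on dead classes (`LiveDepthLE`); DEFINED, NOT asserted: an undominated dead (or deep) class
  MASKS a pocket of live class-tops whose re-convexified hull is not controlled by `TropRowD` — the located open point of the line;
* the depth-free, design-free **octave–Newton lemma** `octaveCount_le_newtonBreaks`: every real polynomial with `t` terms has its
  nonzero real roots in at most `(2(⌊log₂ t⌋ + 1) + 2) · #breaks` dyadic octaves, `#breaks` = number of breakpoints of its TRUE
  archimedean Newton polygon `θ ↦ max_e (log₂|c_e| + e θ)`; for pencils `t ≤ 2^M` (`octaveCount_pencilDet_le_newtonBreaks`).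
Nothing here bears on B / TB / W / Ω-W; VP ≠ VNP is not moved. -/

section DeadClasses

open Finset

variable {m K : ℕ}

/-- raw absolute MASS of the slope class `e`: `Σ_{τ : rawSlope τ = e} |rawCoef τ|` (the left side of `DepthLE` in raw-term form). -/
noncomputable def classMass (d : Fin K → ℕ) (S : Fin K → Matrix (Fin m) (Fin m) ℝ) (e : ℕ) : ℝ :=
  ∑ τ ∈ univ.filter (fun τ : RawTerm m K => rawSlope d τ = e), |rawCoef S τ|

/-- the slope class `e` is DEAD: it carries a present raw term but its coefficient in `det` vanishes (exact cancellation). -/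
def IsDeadClass (d : Fin K → ℕ) (S : Fin K → Matrix (Fin m) (Fin m) ℝ) (e : ℕ) : Prop :=
  (pencilDet d S).coeff e = 0 ∧ ∃ τ : RawTerm m K, rawSlope d τ = e ∧ rawCoef S τ ≠ 0

/-- the slope class `e` reaches the TOP of the design envelope: at some `θ` a present raw term of class `e` is a maximal raw line
(i.e. the class-top point `(e, max log₂|rawCoef|)` lies on the upper hull of the class-top points). -/
def IsTopClass (d : Fin K → ℕ) (S : Fin K → Matrix (Fin m) (Fin m) ℝ) (e : ℕ) : Prop :=
  ∃ θ : ℝ, ∃ τ : RawTerm m K, rawCoef S τ ≠ 0 ∧ rawSlope d τ = e ∧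
    ∀ τ' : RawTerm m K, rawCoef S τ' ≠ 0 → rawLine d S τ' θ ≤ rawLine d S τ θ

/-- **live depth ≤ Δ**: the depth inequality `classMass e ≤ 2^Δ |coeff e|` for every LIVE class (nonzero coefficient); dead classes
are unconstrained.  (`DepthLE` = this for ALL classes, which forces every class with a present term to be live.) -/
def LiveDepthLE (d : Fin K → ℕ) (S : Fin K → Matrix (Fin m) (Fin m) ℝ) (Δ : ℕ) : Prop :=
  ∀ e : ℕ, (pencilDet d S).coeff e ≠ 0 → classMass d S e ≤ (2 : ℝ) ^ Δ * |(pencilDet d S).coeff e|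

/-- **top depth ≤ Δ**: the depth inequality only for classes that reach the top of the design envelope somewhere; classes strictly
below the envelope everywhere (dominated classes) may be dead or arbitrarily deep. -/
def TopDepthLE (d : Fin K → ℕ) (S : Fin K → Matrix (Fin m) (Fin m) ℝ) (Δ : ℕ) : Prop :=
  ∀ e : ℕ, IsTopClass d S e → classMass d S e ≤ (2 : ℝ) ^ Δ * |(pencilDet d S).coeff e|

/-- **dominated-class lifting** (PROVED below, `dominatedClassLifting_proof`): the rung `ShallowOctaveLifting` with `DepthLE`
weakened to `TopDepthLE` — same bound `(2(M+Δ)+3)(n+1)`, `M = m(⌊log₂(mK)⌋+1)`. -/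
def DominatedClassLifting : Prop :=
  ∀ (m K n Δ : ℕ), Summit.ValiantsHypothesis.ValiantsHypothesis.Theorems.KPlusLogSqLaw.TropRowD m K n →
    ∀ (d : Fin K → ℕ) (S : Fin K → Matrix (Fin m) (Fin m) ℝ), TopDepthLE d S Δ →
      octaveCount (pencilDet d S) ≤ (2 * (m * (Nat.log 2 (m * K) + 1) + Δ) + 3) * (n + 1)

/-- **dead-class lifting** («dead slope classes create no octaves»; candidate next rung toward Ω-W, DEFINED, NOT asserted):
the rung's conclusion under `LiveDepthLE` (depth `≤ Δ` on live classes, dead classes free).  PROVED here only in the dominated case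
(`deadClassLifting_of_dominated`).  Why it might fail: an undominated dead class is a vertex of the class-top hull; deleting it
re-convexifies a POCKET of live class-tops, and the number of pocket vertices is not controlled by the tropical row (for `m = 2` the
class-tops are Minkowski sums of the letters' point sets, which contain large convexly independent subsets). -/
def DeadClassLifting : Prop :=
  ∀ (m K n Δ : ℕ), Summit.ValiantsHypothesis.ValiantsHypothesis.Theorems.KPlusLogSqLaw.TropRowD m K n →
    ∀ (d : Fin K → ℕ) (S : Fin K → Matrix (Fin m) (Fin m) ℝ), LiveDepthLE d S Δ →
      octaveCount (pencilDet d S) ≤ (2 * (m * (Nat.log 2 (m * K) + 1) + Δ) + 3) * (n + 1)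

/-- the class mass is the double sum appearing in `DepthLE`. [folklore] -/
theorem classMass_eq (d : Fin K → ℕ) (S : Fin K → Matrix (Fin m) (Fin m) ℝ) (e : ℕ) :
    classMass d S e = ∑ σ : Equiv.Perm (Fin m), ∑ lam : Fin m → Fin K,
      (if (∑ i, d (lam i)) = e then ∏ i, |S (lam i) (σ i) i| else 0) := by
  classical
  rw [classMass, Finset.sum_filter, Fintype.sum_prod_type]
  refine Finset.sum_congr rfl fun σ _ => Finset.sum_congr rfl fun lam _ => ?_
  simp only [rawSlope, abs_rawCoef]

/-- `DepthLE Δ ⇒ TopDepthLE Δ` (the new hypothesis is weaker). [folklore] -/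
theorem topDepthLE_of_depthLE {d : Fin K → ℕ} {S : Fin K → Matrix (Fin m) (Fin m) ℝ} {Δ : ℕ} (h : DepthLE d S Δ) :
    TopDepthLE d S Δ := fun e _ => by rw [classMass_eq]; exact h e

/-- `DepthLE Δ ⇒ LiveDepthLE Δ`. [folklore] -/
theorem liveDepthLE_of_depthLE {d : Fin K → ℕ} {S : Fin K → Matrix (Fin m) (Fin m) ℝ} {Δ : ℕ} (h : DepthLE d S Δ) :
    LiveDepthLE d S Δ := fun e _ => by rw [classMass_eq]; exact h e

/-- a top class with vanishing coefficient is dead. [folklore] -/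
theorem isDeadClass_of_isTopClass {d : Fin K → ℕ} {S : Fin K → Matrix (Fin m) (Fin m) ℝ} {e : ℕ} (ht : IsTopClass d S e)
    (h0 : (pencilDet d S).coeff e = 0) : IsDeadClass d S e := by
  obtain ⟨_, τ, hτ, hs, _⟩ := ht
  exact ⟨h0, τ, hs, hτ⟩

/-- **dominated dead classes cost nothing**: live depth `≤ Δ` and «no dead class reaches the top of the design envelope» give
`TopDepthLE Δ`. [folklore] -/
theorem topDepthLE_of_liveDepthLE_of_dominated {d : Fin K → ℕ} {S : Fin K → Matrix (Fin m) (Fin m) ℝ} {Δ : ℕ}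
    (hlive : LiveDepthLE d S Δ) (hdom : ∀ e, IsDeadClass d S e → ¬ IsTopClass d S e) : TopDepthLE d S Δ := by
  intro e he
  by_cases h0 : (pencilDet d S).coeff e = 0
  · exact absurd he (hdom e (isDeadClass_of_isTopClass he h0))
  · exact hlive e h0

/-- **raw confinement with a ONE-CLASS depth hypothesis** (generalises `rawConfinement`): at a positive root of a signed sum of
monomials, if the class of the chosen nonzero raw term `τ₀` cancels to depth `≤ Δ` bits, then `τ₀` is within a factor `#ι · 2^Δ` of a
raw term of ANOTHER class.  (The proof of `rawConfinement` uses its depth hypothesis only at the class of `τ₀`.) [folklore] -/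
theorem rawConfinement_oneClass {ι : Type*} [Fintype ι] (s : ι → ℕ) (a : ι → ℝ) (ha : ∀ τ, 0 ≤ a τ) (sgn : ι → ℝ)
    (hsgn : ∀ τ, sgn τ = 1 ∨ sgn τ = -1) (Δ : ℕ) (x : ℝ) (hx : 0 < x) (hroot : ∑ τ, sgn τ * a τ * x ^ (s τ) = 0)
    (τ₀ : ι) (ha₀ : 0 < a τ₀)
    (hdepth : (∑ τ ∈ univ.filter (fun τ => s τ = s τ₀), a τ) ≤
      (2 : ℝ) ^ Δ * |∑ τ ∈ univ.filter (fun τ => s τ = s τ₀), sgn τ * a τ|) :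
    ∃ τ₁, s τ₁ ≠ s τ₀ ∧ a τ₀ * x ^ (s τ₀) ≤ Fintype.card ι * (2 : ℝ) ^ Δ * (a τ₁ * x ^ (s τ₁)) := by
  classical
  have habs : ∀ τ, |sgn τ| = 1 := fun τ => by rcases hsgn τ with h | h <;> simp [h]
  have hsplit : ∑ τ, sgn τ * a τ * x ^ (s τ) =
      x ^ (s τ₀) * (∑ τ ∈ univ.filter (fun τ => s τ = s τ₀), sgn τ * a τ) +
        ∑ τ ∈ univ.filter (fun τ => ¬ s τ = s τ₀), sgn τ * a τ * x ^ (s τ) := by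
    rw [← Finset.sum_filter_add_sum_filter_not univ (fun τ => s τ = s τ₀)]
    congr 1
    rw [Finset.mul_sum]
    refine Finset.sum_congr rfl fun τ hτ => ?_
    rw [(mem_filter.1 hτ).2]; ring
  set C := univ.filter (fun τ => s τ = s τ₀) with hC
  set O := univ.filter (fun τ => ¬ s τ = s τ₀) with hO
  set c := ∑ τ ∈ C, sgn τ * a τ with hc
  have hxpos : 0 < x ^ (s τ₀) := pow_pos hx _
  have hkey : x ^ (s τ₀) * |c| ≤ ∑ τ ∈ O, a τ * x ^ (s τ) := by
    have h1 : x ^ (s τ₀) * c = -∑ τ ∈ O, sgn τ * a τ * x ^ (s τ) := by linarith [hsplit.symm.trans hroot]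
    calc x ^ (s τ₀) * |c| = |x ^ (s τ₀) * c| := by rw [abs_mul, abs_of_pos hxpos]
      _ = |∑ τ ∈ O, sgn τ * a τ * x ^ (s τ)| := by rw [h1, abs_neg]
      _ ≤ ∑ τ ∈ O, |sgn τ * a τ * x ^ (s τ)| := abs_sum_le_sum_abs _ _
      _ = ∑ τ ∈ O, a τ * x ^ (s τ) := Finset.sum_congr rfl fun τ _ => by
          rw [abs_mul, abs_mul, habs, one_mul, abs_of_nonneg (ha τ), abs_of_pos (pow_pos hx _)]
  have hτ₀C : τ₀ ∈ C := by simp [hC]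
  have h1 : a τ₀ ≤ (2 : ℝ) ^ Δ * |c| :=
    (Finset.single_le_sum (f := a) (fun τ _ => ha τ) hτ₀C).trans hdepth
  have hO_ne : O.Nonempty := by
    by_contra hemp
    rw [Finset.not_nonempty_iff_eq_empty] at hemp
    have h0 : x ^ (s τ₀) * |c| ≤ 0 := by simpa [hemp] using hkey
    have hcabs : |c| ≤ 0 := by
      by_contra hpos
      push Not at hpos
      have := mul_pos hxpos hpos
      linarith
    have : a τ₀ ≤ 0 := h1.trans (by nlinarith [hcabs, abs_nonneg c, pow_pos (by norm_num : (0:ℝ) < 2) Δ])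
    linarith
  obtain ⟨τ₁, hτ₁O, hmax⟩ := Finset.exists_max_image O (fun τ => a τ * x ^ (s τ)) hO_ne
  refine ⟨τ₁, (mem_filter.1 hτ₁O).2, ?_⟩
  have hpos₁ : 0 ≤ a τ₁ * x ^ (s τ₁) := mul_nonneg (ha τ₁) (pow_pos hx _).le
  have hcard : (O.card : ℝ) ≤ Fintype.card ι := by
    have : O.card ≤ Fintype.card ι := (card_filter_le _ _).trans (Finset.card_univ).le
    exact_mod_cast this
  have hsumO : ∑ τ ∈ O, a τ * x ^ (s τ) ≤ Fintype.card ι * (a τ₁ * x ^ (s τ₁)) :=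
    calc ∑ τ ∈ O, a τ * x ^ (s τ) ≤ ∑ _τ ∈ O, a τ₁ * x ^ (s τ₁) := Finset.sum_le_sum fun τ hτ => hmax τ hτ
      _ = O.card * (a τ₁ * x ^ (s τ₁)) := by rw [Finset.sum_const, nsmul_eq_mul]
      _ ≤ Fintype.card ι * (a τ₁ * x ^ (s τ₁)) := mul_le_mul_of_nonneg_right hcard hpos₁
  calc a τ₀ * x ^ (s τ₀) ≤ (2 : ℝ) ^ Δ * |c| * x ^ (s τ₀) := mul_le_mul_of_nonneg_right h1 hxpos.le
    _ = (2 : ℝ) ^ Δ * (x ^ (s τ₀) * |c|) := by ring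
    _ ≤ (2 : ℝ) ^ Δ * ∑ τ ∈ O, a τ * x ^ (s τ) := mul_le_mul_of_nonneg_left hkey (by positivity)
    _ ≤ (2 : ℝ) ^ Δ * (Fintype.card ι * (a τ₁ * x ^ (s τ₁))) := mul_le_mul_of_nonneg_left hsumO (by positivity)
    _ = Fintype.card ι * (2 : ℝ) ^ Δ * (a τ₁ * x ^ (s τ₁)) := by ring

/-- **depth confinement under `TopDepthLE`** (generalises `rootNearBreakpoint_proof`): every nonzero real root of a nonzero pencil
determinant whose TOP classes have depth `≤ Δ` has `log₂|x|` within `m(⌊log₂(mK)⌋+1) + Δ` of a design breakpoint. [folklore] -/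
theorem rootNearBreakpoint_of_topDepthLE (Δ : ℕ) (d : Fin K → ℕ) (S : Fin K → Matrix (Fin m) (Fin m) ℝ)
    (hΔ : TopDepthLE d S Δ) (x : ℝ) (hx0 : x ≠ 0) (hf0 : pencilDet d S ≠ 0) (hroot : (pencilDet d S).IsRoot x) :
    ∃ b ∈ designBreaks d S, |Real.logb 2 |x| - b| ≤ ((m * (Nat.log 2 (m * K) + 1) + Δ : ℕ) : ℝ) := by
  classical
  set y := |x| with hy_def
  have hy : 0 < y := abs_pos.2 hx0
  have hyne : y ≠ 0 := hy.ne'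
  set u := x / |x| with hu_def
  have hu : u = 1 ∨ u = -1 := sign_div_abs x hx0
  have huy : u * y = x := by rw [hu_def, hy_def]; exact div_mul_cancel₀ x (abs_ne_zero.2 hx0)
  have hupow : ∀ n : ℕ, u ^ n = 1 ∨ u ^ n = -1 := fun n => by
    rcases hu with h | h
    · left; simp [h]
    · rw [h]; exact neg_one_pow_eq_or ℝ n
  -- the data for `rawConfinement_oneClass` over ALL raw terms
  let a : RawTerm m K → ℝ := fun τ => |rawCoef S τ|
  let sg : RawTerm m K → ℝ := fun τ => if rawCoef S τ = 0 then 1 else rawCoef S τ / |rawCoef S τ| * u ^ rawSlope d τ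
  have ha : ∀ τ, 0 ≤ a τ := fun τ => abs_nonneg _
  have hsg : ∀ τ, sg τ = 1 ∨ sg τ = -1 := fun τ => by
    by_cases h : rawCoef S τ = 0
    · left; simp [sg, h]
    · simp only [sg, if_neg h]
      rcases sign_div_abs _ h with h1 | h1 <;> rcases hupow (rawSlope d τ) with h2 | h2 <;> simp [h1, h2]
  have hF1 : ∀ τ, sg τ * a τ = rawCoef S τ * u ^ rawSlope d τ := fun τ => by
    by_cases h : rawCoef S τ = 0
    · simp [sg, a, h]
    · simp only [sg, a, if_neg h]
      field_simp
  have hF2 : ∀ τ, sg τ * a τ * y ^ rawSlope d τ = rawCoef S τ * x ^ rawSlope d τ := fun τ => by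
    rw [hF1, mul_assoc, ← mul_pow, huy]
  -- root equation
  have hroot' : ∑ τ, sg τ * a τ * y ^ (rawSlope d τ) = 0 := by
    simp_rw [hF2]; rw [← eval_pencilDet_eq_sum]; exact hroot
  -- a present term exists, pick the top raw term τ₀
  obtain ⟨e₀, he₀⟩ : ∃ e, (pencilDet d S).coeff e ≠ 0 := by
    by_contra hall; push Not at hall
    exact hf0 (Polynomial.ext fun e => by simpa using hall e)
  obtain ⟨τp, -, hτp⟩ : ∃ τ ∈ univ.filter (fun τ : RawTerm m K => rawSlope d τ = e₀), rawCoef S τ ≠ 0 := by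
    rw [coeff_pencilDet_eq_sum] at he₀
    exact Finset.exists_ne_zero_of_sum_ne_zero he₀
  obtain ⟨τ₀, -, hmax⟩ := Finset.exists_max_image (univ : Finset (RawTerm m K)) (fun τ => a τ * y ^ rawSlope d τ) ⟨τp, mem_univ _⟩
  have hpos_p : 0 < a τp * y ^ rawSlope d τp := mul_pos (abs_pos.2 hτp) (pow_pos hy _)
  have hpos₀ : 0 < a τ₀ * y ^ rawSlope d τ₀ := hpos_p.trans_le (hmax τp (mem_univ _))
  have ha₀ : 0 < a τ₀ := by
    by_contra h; push Not at h
    have : a τ₀ * y ^ rawSlope d τ₀ ≤ 0 := mul_nonpos_of_nonpos_of_nonneg h (pow_pos hy _).le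
    linarith
  have hτ₀p : rawCoef S τ₀ ≠ 0 := abs_pos.1 ha₀
  -- logs of present raw terms
  set θ := Real.logb 2 y with hθ
  have hlog_line : ∀ τ : RawTerm m K, rawCoef S τ ≠ 0 →
      Real.logb 2 (a τ * y ^ rawSlope d τ) = rawLog S τ + (rawSlope d τ : ℤ) * θ := by
    intro τ hτ
    rw [Real.logb_mul (abs_pos.2 hτ).ne' (pow_ne_zero _ hyne), Real.logb_pow, rawLog]
    push_cast; ring
  -- the class of the top raw term is a top class, so the one-class depth hypothesis holds there
  have htopClass : IsTopClass d S (rawSlope d τ₀) := by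
    refine ⟨θ, τ₀, hτ₀p, rfl, fun τ' hτ' => ?_⟩
    have h1 := Real.logb_le_logb_of_le (b := 2) (by norm_num) (mul_pos (abs_pos.2 hτ') (pow_pos hy _)) (hmax τ' (mem_univ _))
    rw [hlog_line τ' hτ', hlog_line τ₀ hτ₀p] at h1
    simpa [rawLine, Int.cast_natCast] using h1
  have hdepth' : (∑ τ ∈ univ.filter (fun τ => rawSlope d τ = rawSlope d τ₀), a τ) ≤
      (2 : ℝ) ^ Δ * |∑ τ ∈ univ.filter (fun τ => rawSlope d τ = rawSlope d τ₀), sg τ * a τ| := by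
    have hL : (∑ τ ∈ univ.filter (fun τ => rawSlope d τ = rawSlope d τ₀), a τ) = classMass d S (rawSlope d τ₀) := rfl
    have hR : (∑ τ ∈ univ.filter (fun τ => rawSlope d τ = rawSlope d τ₀), sg τ * a τ) =
        u ^ rawSlope d τ₀ * (pencilDet d S).coeff (rawSlope d τ₀) := by
      rw [coeff_pencilDet_eq_sum, Finset.mul_sum]
      refine Finset.sum_congr rfl fun τ hτ => ?_
      rw [hF1, (Finset.mem_filter.1 hτ).2, mul_comm]
    rw [hL, hR, abs_mul]
    have : |u ^ rawSlope d τ₀| = 1 := by rcases hupow (rawSlope d τ₀) with h | h <;> simp [h]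
    rw [this, one_mul]
    exact hΔ _ htopClass
  obtain ⟨τ₁, hs₁, hconf⟩ := rawConfinement_oneClass (rawSlope d) a ha sg hsg Δ y hy hroot' τ₀ ha₀ hdepth'
  set N := Fintype.card (RawTerm m K) with hN
  have hNpos : 0 < (N : ℝ) := by
    have : 0 < N := Fintype.card_pos_iff.2 ⟨τ₀⟩
    exact_mod_cast this
  have ha₁ : 0 < a τ₁ := by
    by_contra h; push Not at h
    have h0 : a τ₁ = 0 := le_antisymm h (ha τ₁)
    rw [h0, zero_mul, mul_zero] at hconf
    linarith
  -- pass to logs over PRESENT terms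
  let ι := {τ : RawTerm m K // rawCoef S τ ≠ 0}
  have hτ₁p : rawCoef S τ₁ ≠ 0 := abs_pos.1 ha₁
  have htop : ∀ k : ι, rawLog S k.1 + (rawSlope d k.1 : ℤ) * θ ≤ rawLog S τ₀ + (rawSlope d τ₀ : ℤ) * θ := by
    intro k
    rw [← hlog_line k.1 k.2, ← hlog_line τ₀ hτ₀p]
    exact Real.logb_le_logb_of_le (by norm_num) (mul_pos (abs_pos.2 k.2) (pow_pos hy _)) (hmax k.1 (mem_univ _))
  have hnear : rawLog S τ₀ + (rawSlope d τ₀ : ℤ) * θ ≤ rawLog S τ₁ + (rawSlope d τ₁ : ℤ) * θ + (Real.logb 2 N + Δ) := by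
    rw [← hlog_line τ₀ hτ₀p, ← hlog_line τ₁ hτ₁p]
    have h1 := Real.logb_le_logb_of_le (b := 2) (by norm_num) hpos₀ hconf
    have h2 : Real.logb 2 (N * (2 : ℝ) ^ Δ * (a τ₁ * y ^ rawSlope d τ₁)) =
        Real.logb 2 N + Δ + Real.logb 2 (a τ₁ * y ^ rawSlope d τ₁) := by
      rw [Real.logb_mul (by positivity) (mul_pos ha₁ (pow_pos hy _)).ne', Real.logb_mul hNpos.ne' (by positivity),
        Real.logb_pow, Real.logb_self_eq_one (by norm_num)]
      ring
    linarith
  have hs₁' : ((rawSlope d τ₀ : ℕ) : ℤ) ≠ ((rawSlope d τ₁ : ℕ) : ℤ) := by exact_mod_cast (Ne.symm hs₁)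
  obtain ⟨b, hb, k, l, hkl, htie, hall⟩ := envelopeGap (ι := ι) (fun t => (rawSlope d t.1 : ℤ)) (fun t => rawLog S t.1)
    (Real.logb 2 N + Δ) θ ⟨τ₀, hτ₀p⟩ ⟨τ₁, hτ₁p⟩ hs₁' htop hnear
  -- identify b as the design breakpoint of (k, l)
  have hkl' : (rawSlope d k.1 : ℝ) ≠ rawSlope d l.1 := by
    intro h; apply hkl; exact_mod_cast (show rawSlope d k.1 = rawSlope d l.1 by exact_mod_cast h)
  have hbcross : rawCross d S (k.1, l.1) = b := by
    rw [rawCross]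
    have htie' : rawLog S k.1 + (rawSlope d k.1 : ℝ) * b = rawLog S l.1 + (rawSlope d l.1 : ℝ) * b := by
      simpa [Int.cast_natCast] using htie
    rw [div_eq_iff (sub_ne_zero.2 (Ne.symm hkl'))]
    linarith
  refine ⟨b, ?_, ?_⟩
  · rw [designBreaks, Finset.mem_image]
    refine ⟨(k.1, l.1), ?_, hbcross⟩
    rw [Finset.mem_filter]
    refine ⟨mem_univ _, k.2, l.2, fun h => hkl (by exact_mod_cast h), fun t ht => ?_⟩
    rw [hbcross]
    have := hall ⟨t, ht⟩
    simpa [Int.cast_natCast] using this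
  · calc |θ - b| ≤ Real.logb 2 N + Δ := hb
      _ ≤ (m * (Nat.log 2 (m * K) + 1) : ℕ) + Δ := by
          have hc := card_rawTerm_le m K
          have h1 : (N : ℝ) ≤ (2 : ℝ) ^ (m * (Nat.log 2 (m * K) + 1)) := by rw [hN]; exact_mod_cast hc
          have h2 := Real.logb_le_logb_of_le (b := 2) (by norm_num) hNpos h1
          rw [Real.logb_pow, Real.logb_self_eq_one (by norm_num), mul_one] at h2
          push_cast at h2 ⊢
          linarith
      _ = ((m * (Nat.log 2 (m * K) + 1) + Δ : ℕ) : ℝ) := by push_cast; ring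

/-- **dominated-class lifting, PROVED**: the rung's bound verbatim under `TopDepthLE` (design breakpoints `≤ n` by
`designPiecesBound_proof`, confinement by `rootNearBreakpoint_of_topDepthLE`, cells by `cellCount_proof`). -/
theorem dominatedClassLifting_proof : DominatedClassLifting := by
  intro m K n Δ hT d S hΔ
  have hB : (designBreaks d S).card ≤ n := designPiecesBound_proof m K n hT d S
  have hW := cellCount_proof (pencilDet d S) (designBreaks d S) (m * (Nat.log 2 (m * K) + 1) + Δ)
    (fun x hx hp hr => rootNearBreakpoint_of_topDepthLE Δ d S hΔ x hx hp hr)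
  calc octaveCount (pencilDet d S) ≤ (2 * (m * (Nat.log 2 (m * K) + 1) + Δ) + 2) * (designBreaks d S).card := hW
    _ ≤ (2 * (m * (Nat.log 2 (m * K) + 1) + Δ) + 2) * n := Nat.mul_le_mul_left _ hB
    _ ≤ (2 * (m * (Nat.log 2 (m * K) + 1) + Δ) + 3) * (n + 1) := Nat.mul_le_mul (Nat.le_succ _) (Nat.le_succ _)

/-- the new rung implies the old one (`TopDepthLE` is weaker than `DepthLE`). [folklore] -/
theorem shallowOctaveLifting_of_dominatedClassLifting (h : DominatedClassLifting) : ShallowOctaveLifting :=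
  fun m K n Δ hT d S hΔ => h m K n Δ hT d S (topDepthLE_of_depthLE hΔ)

/-- **first structural case of dead-class lifting, PROVED**: if no dead class reaches the top of the design envelope
(every dead class-top lies weakly below the live envelope), dead classes create no octaves — the rung's bound holds under
`LiveDepthLE Δ`. -/
theorem deadClassLifting_of_dominated (m K n Δ : ℕ)
    (hT : Summit.ValiantsHypothesis.ValiantsHypothesis.Theorems.KPlusLogSqLaw.TropRowD m K n)
    (d : Fin K → ℕ) (S : Fin K → Matrix (Fin m) (Fin m) ℝ) (hlive : LiveDepthLE d S Δ)
    (hdom : ∀ e, IsDeadClass d S e → ¬ IsTopClass d S e) :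
    octaveCount (pencilDet d S) ≤ (2 * (m * (Nat.log 2 (m * K) + 1) + Δ) + 3) * (n + 1) :=
  dominatedClassLifting_proof m K n Δ hT d S (topDepthLE_of_liveDepthLE_of_dominated hlive hdom)

end DeadClasses

end Summit.ValiantsHypothesis.ValiantsHypothesis.Theorems.KPlusLogSqLaw.Octave
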